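import Summits.QuantumFields.YangMills.Theorems.WeakCouplingRatesBulkDominatesColdBoxWCrudeGoodLargeField
import Summits.QuantumFields.YangMills.Theorems.WeakCouplingRatesColdBoxGoodReduction

/-!
# Crux `BulkDominatesColdBoxW` (stmt-QuantumFields-19609), expansion stubs `stub_kernelMeanExpansion` / `stub_kernelCovExpansion`: conditioning
# the box kernel with a crude-good datum on the small-field event `coldGoodSet` (helper H-T6, YM side — trunk-independent)

Uniformly over crude-good data `ω` (scale `β^{2δ−1}`, box `H = ⌈β^θ⌉`), the box kernel `γ(·|ω) = boxKernel β H ω` gives the large-field event mass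
`≤ e^{−β^ε}` for `ε > 3θ + δ` (`boxKernel_largeField_rarity_crudeGood`, seat g0); hence (tree `abs_integral_sub_integral_cond_le`, `abs_cov_sub_cov_cond_le`)
conditioning on `coldGoodSet β ε H` moves bounded means by `≤ 2M·e^{−β^ε}` and bounded connected two-point functions by `≤ 6M_fM_g·e^{−β^ε}` — the YM-side
restriction step of the one-scale expansions with datum (the flat case is `abs_boxPlaqCov_sub_cond_le`, `Theorems/WeakCouplingRatesColdBoxGoodReduction.lean`).
Typed signatures = the stub-ideation sketch `Sketch-sidea-k1-r3.lean` (item evidence #33), `abs_boxKernel_integral_sub_cond_le` / `abs_boxKernel_cov_sub_cond_le`.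

* `boxKernel_real_coldGoodSet_compl_le` — `γ((coldGoodSet)ᶜ|ω) ≤ e^{−β^ε}` eventually, ∀ crude-good `ω`;
* `isProbabilityMeasure_boxKernel`, `boxKernel_coldGoodSet_ne_zero`;
* **`abs_boxKernel_integral_sub_cond_le`**, **`abs_boxKernel_cov_sub_cond_le`**.

Fleet seat `ym-spine-20043-p1` (g3).  No sorry, standard axioms, no new definition, no named-fact hypothesis.  NOT a claim about the mass gap.
-/

set_option autoImplicit false

noncomputable section

open MeasureTheory ProbabilityTheory Finset Real
open Literature.Probability.LatticeModels
open Literature.MathematicalPhysics.QuantumLattice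
open Literature.MathematicalPhysics.QuantumFieldTheory
open Literature.MathematicalPhysics.QuantumFieldTheory.AxialGauge

namespace Summit.QuantumFields.YangMills.Theorems.WeakCouplingRates

/-- The box kernel is a probability measure. -/
theorem isProbabilityMeasure_boxKernel (β : ℝ) (H : ℕ) (ω : LGConfig 4 (Matrix.specialUnitaryGroup (Fin 2) ℂ)) :
    IsProbabilityMeasure (boxKernel β H ω) := by
  haveI := secondCountableTopology_SU2
  unfold boxKernel
  exact isProbabilityMeasure_ymSpecification _ (continuous_fundamentalRep (Fin 2)) β _ _

/-- **Large fields under the kernel, uniformly over crude-good data**: for `0 < θ`, `0 ≤ δ`, `3θ + δ < ε`, eventually in `β`, for every crude-good `ω`,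
`boxKernel β H ω (coldGoodSet β ε H)ᶜ ≤ e^{−β^ε}` (`H = ⌈β^θ⌉`). -/
theorem boxKernel_real_coldGoodSet_compl_le {θ δ ε : ℝ} (hθ : 0 < θ) (hδ : 0 ≤ δ) (hε : 3 * θ + δ < ε) :
    ∃ β₀ : ℝ, ∀ β : ℝ, β₀ ≤ β → ∀ ω : LGConfig 4 (Matrix.specialUnitaryGroup (Fin 2) ℂ), CrudeGood β δ ⌈β ^ θ⌉₊ ω →
      (boxKernel β ⌈β ^ θ⌉₊ ω).real (coldGoodSet β ε ⌈β ^ θ⌉₊)ᶜ ≤ Real.exp (-(β ^ ε)) := by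
  obtain ⟨β₀, hβ₀⟩ := boxKernel_largeField_rarity_crudeGood hθ hδ hε
  refine ⟨β₀, fun β hβ ω hω => ?_⟩
  rw [coldGoodSet, compl_compl]
  exact hβ₀ β hβ ω hω

/-- Eventually the good event has positive kernel mass (its complement has mass `≤ e^{−β^ε} < 1`). -/
theorem boxKernel_coldGoodSet_ne_zero {β ε : ℝ} (hβ : 0 < β) {H : ℕ} {ω : LGConfig 4 (Matrix.specialUnitaryGroup (Fin 2) ℂ)}
    (hbad : (boxKernel β H ω).real (coldGoodSet β ε H)ᶜ ≤ Real.exp (-(β ^ ε))) :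
    boxKernel β H ω (coldGoodSet β ε H) ≠ 0 := by
  haveI := isProbabilityMeasure_boxKernel β H ω
  have hbad1 : (boxKernel β H ω).real (coldGoodSet β ε H)ᶜ < 1 := lt_of_le_of_lt hbad (by
    rw [Real.exp_lt_one_iff]
    have : 0 < β ^ ε := Real.rpow_pos_of_pos hβ ε
    linarith)
  intro h0
  have h1 : (boxKernel β H ω).real (coldGoodSet β ε H) = 0 := by rw [measureReal_def, h0, ENNReal.toReal_zero]
  have h2 : (boxKernel β H ω).real (coldGoodSet β ε H) + (boxKernel β H ω).real (coldGoodSet β ε H)ᶜ = 1 := by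
    rw [measureReal_add_measureReal_compl (measurableSet_coldGoodSet β ε H), probReal_univ]
  linarith

/-- **H-T6 for MEANS (the `KernelMeanExpansion` restriction step)**: for `0 < θ`, `0 ≤ δ`, `3θ + δ < ε`, eventually in `β`, for every crude-good datum
`ω` and every bounded measurable observable `f` (`|f| ≤ M_f`),
`|E_{γ(·|ω)}[f] − E_{γ(·|ω)}[f | coldGoodSet]| ≤ 2M_f·e^{−β^ε}`. -/
theorem abs_boxKernel_integral_sub_cond_le {θ δ ε : ℝ} (hθ : 0 < θ) (hδ : 0 ≤ δ) (hε : 3 * θ + δ < ε) :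
    ∃ β₀ : ℝ, ∀ β : ℝ, β₀ ≤ β → ∀ ω : LGConfig 4 (Matrix.specialUnitaryGroup (Fin 2) ℂ), CrudeGood β δ ⌈β ^ θ⌉₊ ω →
      ∀ (f : LGConfig 4 (Matrix.specialUnitaryGroup (Fin 2) ℂ) → ℝ) (Mf : ℝ), Measurable f → (∀ U, |f U| ≤ Mf) →
        |(∫ U, f U ∂(boxKernel β ⌈β ^ θ⌉₊ ω)) - ∫ U, f U ∂((boxKernel β ⌈β ^ θ⌉₊ ω)[|coldGoodSet β ε ⌈β ^ θ⌉₊])| ≤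
          2 * Mf * Real.exp (-(β ^ ε)) := by
  obtain ⟨β₀, hβ₀⟩ := boxKernel_real_coldGoodSet_compl_le hθ hδ hε
  refine ⟨max β₀ 1, fun β hβ ω hω f Mf hfm hM => ?_⟩
  have hb0 : β₀ ≤ β := (le_max_left _ _).trans hβ
  have hβ1 : (1 : ℝ) ≤ β := (le_max_right _ _).trans hβ
  set μ := boxKernel β ⌈β ^ θ⌉₊ ω with hμ
  haveI : IsProbabilityMeasure μ := isProbabilityMeasure_boxKernel β _ ω
  have hbad : μ.real (coldGoodSet β ε ⌈β ^ θ⌉₊)ᶜ ≤ Real.exp (-(β ^ ε)) := hβ₀ β hb0 ω hω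
  have hG0 : μ (coldGoodSet β ε ⌈β ^ θ⌉₊) ≠ 0 := boxKernel_coldGoodSet_ne_zero (by linarith) hbad
  have hMf0 : 0 ≤ Mf := (abs_nonneg _).trans (hM fun _ => 1)
  have hfi : Integrable f μ := integrable_of_bound hfm.aestronglyMeasurable hM
  have key := abs_integral_sub_integral_cond_le (μ := μ) (measurableSet_coldGoodSet β ε _) hG0 hfi hM
  calc _ ≤ 2 * Mf * μ.real (coldGoodSet β ε ⌈β ^ θ⌉₊)ᶜ := key
    _ ≤ 2 * Mf * Real.exp (-(β ^ ε)) := mul_le_mul_of_nonneg_left hbad (by positivity)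

/-- **H-T6 for COVARIANCES (the `KernelCovExpansion` restriction step)**: for `0 < θ`, `0 ≤ δ`, `3θ + δ < ε`, eventually in `β`, for every crude-good
datum `ω` and bounded measurable `f, g` (`|f| ≤ M_f`, `|g| ≤ M_g`),
`|Cov_{γ(·|ω)}(f,g) − Cov_{γ(·|ω)[|coldGoodSet]}(f,g)| ≤ 6M_fM_g·e^{−β^ε}`. -/
theorem abs_boxKernel_cov_sub_cond_le {θ δ ε : ℝ} (hθ : 0 < θ) (hδ : 0 ≤ δ) (hε : 3 * θ + δ < ε) :
    ∃ β₀ : ℝ, ∀ β : ℝ, β₀ ≤ β → ∀ ω : LGConfig 4 (Matrix.specialUnitaryGroup (Fin 2) ℂ), CrudeGood β δ ⌈β ^ θ⌉₊ ω →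
      ∀ (f g : LGConfig 4 (Matrix.specialUnitaryGroup (Fin 2) ℂ) → ℝ) (Mf Mg : ℝ), Measurable f → Measurable g →
        (∀ U, |f U| ≤ Mf) → (∀ U, |g U| ≤ Mg) →
        |((∫ U, f U * g U ∂(boxKernel β ⌈β ^ θ⌉₊ ω)) -
              (∫ U, f U ∂(boxKernel β ⌈β ^ θ⌉₊ ω)) * (∫ U, g U ∂(boxKernel β ⌈β ^ θ⌉₊ ω))) -
            ((∫ U, f U * g U ∂((boxKernel β ⌈β ^ θ⌉₊ ω)[|coldGoodSet β ε ⌈β ^ θ⌉₊])) -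
              (∫ U, f U ∂((boxKernel β ⌈β ^ θ⌉₊ ω)[|coldGoodSet β ε ⌈β ^ θ⌉₊])) *
                (∫ U, g U ∂((boxKernel β ⌈β ^ θ⌉₊ ω)[|coldGoodSet β ε ⌈β ^ θ⌉₊])))| ≤
          6 * Mf * Mg * Real.exp (-(β ^ ε)) := by
  obtain ⟨β₀, hβ₀⟩ := boxKernel_real_coldGoodSet_compl_le hθ hδ hε
  refine ⟨max β₀ 1, fun β hβ ω hω f g Mf Mg hfm hgm hMf hMg => ?_⟩
  have hb0 : β₀ ≤ β := (le_max_left _ _).trans hβ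
  have hβ1 : (1 : ℝ) ≤ β := (le_max_right _ _).trans hβ
  set μ := boxKernel β ⌈β ^ θ⌉₊ ω with hμ
  haveI : IsProbabilityMeasure μ := isProbabilityMeasure_boxKernel β _ ω
  have hbad : μ.real (coldGoodSet β ε ⌈β ^ θ⌉₊)ᶜ ≤ Real.exp (-(β ^ ε)) := hβ₀ β hb0 ω hω
  have hG0 : μ (coldGoodSet β ε ⌈β ^ θ⌉₊) ≠ 0 := boxKernel_coldGoodSet_ne_zero (by linarith) hbad
  have hMf0 : 0 ≤ Mf := (abs_nonneg _).trans (hMf fun _ => 1)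
  have hMg0 : 0 ≤ Mg := (abs_nonneg _).trans (hMg fun _ => 1)
  have hfi : Integrable f μ := integrable_of_bound hfm.aestronglyMeasurable hMf
  have hgi : Integrable g μ := integrable_of_bound hgm.aestronglyMeasurable hMg
  have hfgi : Integrable (fun U => f U * g U) μ := integrable_of_bound (hfm.mul hgm).aestronglyMeasurable (C := Mf * Mg)
    (fun U => by rw [abs_mul]; exact mul_le_mul (hMf U) (hMg U) (abs_nonneg _) hMf0)
  have key := abs_cov_sub_cov_cond_le (μ := μ) (measurableSet_coldGoodSet β ε _) hG0 hfi hgi hfgi hMf hMg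
  calc _ ≤ 6 * Mf * Mg * μ.real (coldGoodSet β ε ⌈β ^ θ⌉₊)ᶜ := key
    _ ≤ 6 * Mf * Mg * Real.exp (-(β ^ ε)) := mul_le_mul_of_nonneg_left hbad (by positivity)

end Summit.QuantumFields.YangMills.Theorems.WeakCouplingRates

end
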